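import Summits.PneNP.PneNP.Theses.MonochromaticLines

/-!
# Route MonochromaticLines — `CollisionReduces` (stmt-PneNP-11762)

A polynomial-time MONO-LINE solver IS a polynomial-time collision finder for the same circuits read as a hash
`[3ⁿ] → [2^⌊n/10⌋]`: the first two points `x ≠ y` of a monochromatic line `(x, y, z)` collide (`C(x) = C(y)`), and the
collision predicate reads exactly the first two components of the same triple code, so the solver itself is the reduction.
-/

set_option linter.dupNamespace false -- `Summit.PneNP.PneNP.…`: summit = sub-problem name (D-0017 single-conjunct layout)

namespace Summit.PneNP.PneNP.Theorems

/-- **Support item `CollisionReduces` of route MonochromaticLines (stmt-PneNP-11762)**: a polynomial-time mono-line solver is a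
polynomial-time collision finder (same function; a monochromatic line's first two points collide).
[cite: KomargodskiNaorYogev2019, §1] [folklore] -/
theorem monochromaticLines_collisionReduces_proof : Summit.PneNP.PneNP.Theses.MonochromaticLines.CollisionReduces := by
  unfold Summit.PneNP.PneNP.Theses.MonochromaticLines.CollisionReduces
  intro IsLine col Valid dec SolStr wire code encI CollStr
  rintro ⟨f, hf, hpoly⟩
  refine ⟨f, fun I hI => ?_, hpoly⟩
  have h := hf I hI
  simp only [SolStr, IsLine] at h
  simp only [CollStr]
  obtain ⟨⟨hx, hy, -, hxy, -, -, -⟩, hc1, -⟩ := h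
  exact ⟨hx, hy, hxy, hc1⟩

end Summit.PneNP.PneNP.Theorems
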